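import Summits.NavierStokesRegularity.NavierStokesRegularity.Theses.ScaledTopAlignment
import Summits.NavierStokesRegularity.NavierStokesRegularity.Theorems.ScaledTopAlignmentMostTimesRegularCase
import Summits.NavierStokesRegularity.NavierStokesRegularity.Theorems.ScaledTopAlignmentAprioriMostTimesBulkAlignmentStubRegularNearMaxCoherence
import Summits.NavierStokesRegularity.NavierStokesRegularity.Theorems.ScaledTopAlignmentExistsAnchorRung
import Summits.NavierStokesRegularity.NavierStokesRegularity.Theorems.CirculationFloor.Negative.ClayVacuity
import HarnessLib

/-!
# Route `ScaledTopAlignment`: the deciding crux W3ᵐᵗ (stmt-NavierStokesRegularity-19551), its one OPEN stub and the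
# re-anchored door are ON-PATH and SUMMIT-EQUIVALENT modulo the residual — kernel certificates BY NAME

The lead's 3-stub class-#2 cut of the crux `AprioriMostTimesBulkAlignment` has one open stub,
`stub_singularNearMaxCoherence` (H₂ at singular solutions); ns-sta-19551-p3's certificate
`singularNearMaxCoherence_hardCore` places it ABOVE the hard core (stub ⇒ `ThreadingFlux.Target`, and
`NoTypeII → (stub ↔ Target)`). This file adds the placement FROM ABOVE, i.e. from the summit, which the crux's
disprover and the tribunal need: every statement in the line is implied by Clay (A), so none can be refuted without
refuting the summit, and together with the residual each is EXACTLY the summit.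

* `false_of_navierStokesRegularity_of_singular` — under `NavierStokesRegularity` no classical Leray–Hopf solution from
  a rapidly decaying datum fails to extend past `T` (the tree's blow-up assembly + Clay-class uniqueness, packaged in
  `CirculationFloor.Negative.circulationFloor_hypotheses_iff_not_navierStokesRegularity`);
* `aprioriMostTimesBulkAlignment_of_navierStokesRegularity` — **S ⇒ 19551** (regular case
  `mostTimesBulkAlignedAt_of_hasSmoothExtensionPast` at every solution); `noTypeII_of_navierStokesRegularity` — S ⇒ the
  residual (vacuity); **`navierStokesRegularity_iff_aprioriMostTimesBulkAlignment_and_noTypeII`** — the route's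
  conjunct split `S ⟸ W3ᵐᵗ ∧ NoTypeII` (`ScaledTopAlignment.closes`) is EXACT: `S ↔ W3ᵐᵗ ∧ NoTypeII`;
* `singularNearMaxCoherence_of_navierStokesRegularity` — **S ⇒ the open stub** (vacuity), and
  **`navierStokesRegularity_iff_singularNearMaxCoherence_and_noTypeII`** — `S ↔ stub ∧ NoTypeII` (⇐: the landed stubs
  `stub_regularNearMaxCoherence`, `stub_coherence_to_mostTimes` and `closes`);
* `existsAnchorDoor_of_navierStokesRegularity`, `navierStokesRegularity_iff_existsAnchorDoor_and_noTypeII` — the same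
  for the planner's banked re-anchored door W3ᵐᵗ-∃e (rev21; bridge `ScaledTopAlignmentExistsAnchorGlueKit`).

So, in the kernel: `Target ⟸ stub ⟸ S`, `Target ⟸ W3ᵐᵗ-∃e ⟸ W3ᵐᵗ ⟸ S`, and given `NoTypeII` all five coincide. Pure
logic over landed theorems; nothing here proves or refutes any of them. WHAT THIS IS NOT: not NS regularity.
-/

noncomputable section

-- the summit and its single sub-problem share the name (CONVENTIONS §1), as in every Theorems file
set_option linter.dupNamespace false

open MeasureTheory Set Filter Topology
open Literature.Analysis Literature.Analysis.FluidPDE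

namespace Summit.NavierStokesRegularity.NavierStokesRegularity.Theorems

/-! ### Under the summit the class has no singular member -/

/-- **Under Clay (A) no classical Leray–Hopf solution from a rapidly decaying datum fails to extend past `T`.**
(The tree's blow-up assembly with the proved Clay-class uniqueness, via
`CirculationFloor.Negative.circulationFloor_hypotheses_iff_not_navierStokesRegularity`.) [folklore] -/
theorem false_of_navierStokesRegularity_of_singular (hA : _root_.NavierStokesRegularity) {ν T : ℝ} (hν : 0 < ν)
    (hT : 0 < T) {u : ℝ → EuclideanSpace ℝ (Fin 3) → EuclideanSpace ℝ (Fin 3)} {p : ℝ → EuclideanSpace ℝ (Fin 3) → ℝ}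
    (hcl : IsClassicalNSSolutionOn (Set.Ico 0 T) ν 0 u p) (hLH : IsLerayHopfOn T ν 0 (u 0) u)
    (hdec : HasRapidSpatialDecay (u 0)) (hext : ¬ HasSmoothExtensionPast ν 0 u T) : False :=
  CirculationFloor.Negative.circulationFloor_hypotheses_iff_not_navierStokesRegularity.1
    ⟨ν, T, u, p, hν, hT, hcl, hLH, hdec, hext⟩ hA

/-! ### The crux and the residual are on-path; the split is exact -/

/-- **S ⇒ W3ᵐᵗ (stmt-19551), BY NAME**: under Clay (A) every solution of the class extends past `T`, and an extending
solution satisfies the door's clause (`mostTimesBulkAlignedAt_of_hasSmoothExtensionPast`). So the deciding crux cannot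
be refuted without refuting the summit. [folklore] -/
theorem aprioriMostTimesBulkAlignment_of_navierStokesRegularity (hA : _root_.NavierStokesRegularity) :
    Summit.NavierStokesRegularity.NavierStokesRegularity.Theses.ScaledTopAlignment.AprioriMostTimesBulkAlignment := by
  intro ν T hν hT u p hcl hLH hdec
  by_cases hext : HasSmoothExtensionPast ν 0 u T
  · exact mostTimesBulkAlignedAt_of_hasSmoothExtensionPast hν hT hcl hLH hdec hext
  · exact (false_of_navierStokesRegularity_of_singular hA hν hT hcl hLH hdec hext).elim

/-- **S ⇒ NoTypeII (the route's residual decl), BY NAME** (vacuity: under Clay (A) no solution of the class is maximal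
at a finite `T`). [folklore] -/
theorem noTypeII_of_navierStokesRegularity (hA : _root_.NavierStokesRegularity) :
    Summit.NavierStokesRegularity.NavierStokesRegularity.Theses.ScaledTopAlignment.NoTypeII := by
  intro ν T hν hT u p hmax hLH hdec
  exact (false_of_navierStokesRegularity_of_singular hA hν hT hmax.1 hLH hdec hmax.2).elim

/-- **The route's conjunct split is EXACT: `S ↔ W3ᵐᵗ ∧ NoTypeII`** (⇐ is the route's deciding theorem
`ScaledTopAlignment.closes`; ⇒ by the two on-path lemmas). [folklore] -/
theorem navierStokesRegularity_iff_aprioriMostTimesBulkAlignment_and_noTypeII :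
    _root_.NavierStokesRegularity ↔
      (Summit.NavierStokesRegularity.NavierStokesRegularity.Theses.ScaledTopAlignment.AprioriMostTimesBulkAlignment ∧
        Summit.NavierStokesRegularity.NavierStokesRegularity.Theses.ScaledTopAlignment.NoTypeII) :=
  ⟨fun hA => ⟨aprioriMostTimesBulkAlignment_of_navierStokesRegularity hA, noTypeII_of_navierStokesRegularity hA⟩,
    fun h => Summit.NavierStokesRegularity.NavierStokesRegularity.Theses.ScaledTopAlignment.closes h.1 h.2⟩

/-! ### The one open stub of the birth line is on-path and summit-equivalent modulo the residual -/

/-- **S ⇒ the open stub `stub_singularNearMaxCoherence`** (its registered statement, written out): vacuous under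
Clay (A), since then no solution of the class is singular at `T`. Hence the stub cannot be refuted without refuting
the summit; with ns-sta-19551-p3's `singularNearMaxCoherence_hardCore` (stub ⇒ Target 1217) it is pinned between the
hard core and the summit. [folklore] -/
theorem singularNearMaxCoherence_of_navierStokesRegularity (hA : _root_.NavierStokesRegularity) :
    ∀ (ν T : ℝ), 0 < ν → 0 < T → ∀ (u : ℝ → EuclideanSpace ℝ (Fin 3) → EuclideanSpace ℝ (Fin 3))
      (p : ℝ → EuclideanSpace ℝ (Fin 3) → ℝ), IsClassicalNSSolutionOn (Set.Ico 0 T) ν 0 u p →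
      IsLerayHopfOn T ν 0 (u 0) u → HasRapidSpatialDecay (u 0) → ¬ HasSmoothExtensionPast ν 0 u T →
      ∃ lam0 : ℝ, lam0 < 1 ∧ ∃ R0 : ℝ, 0 < R0 ∧ ∃ η : ℝ → ℝ, Tendsto η (𝓝[>] 0) (𝓝 0) ∧
        ∀ κ : ℝ, 0 < κ → ∃ M : ℝ, 0 < M ∧ ∀ t ∈ Set.Ico 0 T, ∀ x y : EuclideanSpace ℝ (Fin 3),
          M ≤ ‖curl (u t) x‖ → κ / (T - t) ≤ ‖curl (u t) x‖ → lam0 * ‖curl (u t) x‖ ≤ ‖curl (u t) y‖ →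
          ‖x - y‖ ≤ R0 * Real.sqrt (ν / ‖curl (u t) x‖) → x ≠ y →
          ‖(‖curl (u t) x‖⁻¹ • curl (u t) x) - (‖curl (u t) y‖⁻¹ • curl (u t) y)‖ ≤ η ‖x - y‖ :=
  fun _ _ hν hT _ _ hcl hLH hdec hext =>
    (false_of_navierStokesRegularity_of_singular hA hν hT hcl hLH hdec hext).elim

/-- **`S ↔ stub ∧ NoTypeII`: the open stub is EXACTLY the summit modulo the route's residual.** (⇒) vacuity twice;
(⇐) the stub and the landed regular case give H₂ at every solution
(`aprioriRelLevelWindowCoherence_of_singularNearMaxCoherence`), the landed kit stub `stub_coherence_to_mostTimes` turns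
H₂ into the door's clause, and the route's `closes` adds NoTypeII. [folklore] -/
theorem navierStokesRegularity_iff_singularNearMaxCoherence_and_noTypeII :
    _root_.NavierStokesRegularity ↔
      ((∀ (ν T : ℝ), 0 < ν → 0 < T → ∀ (u : ℝ → EuclideanSpace ℝ (Fin 3) → EuclideanSpace ℝ (Fin 3))
          (p : ℝ → EuclideanSpace ℝ (Fin 3) → ℝ), IsClassicalNSSolutionOn (Set.Ico 0 T) ν 0 u p →
          IsLerayHopfOn T ν 0 (u 0) u → HasRapidSpatialDecay (u 0) → ¬ HasSmoothExtensionPast ν 0 u T →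
          ∃ lam0 : ℝ, lam0 < 1 ∧ ∃ R0 : ℝ, 0 < R0 ∧ ∃ η : ℝ → ℝ, Tendsto η (𝓝[>] 0) (𝓝 0) ∧
            ∀ κ : ℝ, 0 < κ → ∃ M : ℝ, 0 < M ∧ ∀ t ∈ Set.Ico 0 T, ∀ x y : EuclideanSpace ℝ (Fin 3),
              M ≤ ‖curl (u t) x‖ → κ / (T - t) ≤ ‖curl (u t) x‖ → lam0 * ‖curl (u t) x‖ ≤ ‖curl (u t) y‖ →
              ‖x - y‖ ≤ R0 * Real.sqrt (ν / ‖curl (u t) x‖) → x ≠ y →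
              ‖(‖curl (u t) x‖⁻¹ • curl (u t) x) - (‖curl (u t) y‖⁻¹ • curl (u t) y)‖ ≤ η ‖x - y‖) ∧
        Summit.NavierStokesRegularity.NavierStokesRegularity.Theses.ScaledTopAlignment.NoTypeII) := by
  refine ⟨fun hA => ⟨singularNearMaxCoherence_of_navierStokesRegularity hA, noTypeII_of_navierStokesRegularity hA⟩,
    fun h => ?_⟩
  refine Summit.NavierStokesRegularity.NavierStokesRegularity.Theses.ScaledTopAlignment.closes
    (fun ν T hν hT u p hcl hLH hdec => ?_) h.2
  exact stub_coherence_to_mostTimes ν T hν hT u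
    (aprioriRelLevelWindowCoherence_of_singularNearMaxCoherence h.1 ν T hν hT u p hcl hLH hdec)

/-! ### The re-anchored door is on-path and summit-equivalent modulo the residual -/

/-- **S ⇒ W3ᵐᵗ-∃e** (the planner's banked re-anchored door rev21, written out): through S ⇒ W3ᵐᵗ and dominance
`aprioriMostTimesBulkAlignmentExistsAnchor_of_aprioriMostTimesBulkAlignment`. [folklore] -/
theorem existsAnchorDoor_of_navierStokesRegularity (hA : _root_.NavierStokesRegularity) :
    ∀ (ν T : ℝ), 0 < ν → 0 < T → ∀ (u : ℝ → EuclideanSpace ℝ (Fin 3) → EuclideanSpace ℝ (Fin 3))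
      (p : ℝ → EuclideanSpace ℝ (Fin 3) → ℝ), IsClassicalNSSolutionOn (Set.Ico 0 T) ν 0 u p →
      IsLerayHopfOn T ν 0 (u 0) u → HasRapidSpatialDecay (u 0) →
      ∃ lam0 : ℝ, lam0 < 1 ∧ ∃ R0 : ℝ, 0 < R0 ∧ ∃ θ : ℝ, θ < 1 ∧ ∀ κ : ℝ, 0 < κ → ∀ ε : ℝ, 0 < ε →
        ∀ δ : ℝ, 0 < δ → ∃ M : ℝ, 0 < M ∧ ∃ E : Set ℝ,
        (∃ h0 : ℝ, 0 < h0 ∧ ∀ h : ℝ, 0 < h → h < h0 →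
          MeasureTheory.volume (E ∩ Set.Ioo (T - h) T) ≤ ENNReal.ofReal (θ * h)) ∧
        ∀ t ∈ Set.Ico 0 T, t ∉ E → ∀ x : EuclideanSpace ℝ (Fin 3), M ≤ ‖curl (u t) x‖ →
          κ / (T - t) ≤ ‖curl (u t) x‖ → ∃ e : EuclideanSpace ℝ (Fin 3), ‖e‖ = 1 ∧
            MeasureTheory.volume {y : EuclideanSpace ℝ (Fin 3) | lam0 * ‖curl (u t) x‖ ≤ ‖curl (u t) y‖ ∧
                ‖x - y‖ ≤ R0 * Real.sqrt (ν / ‖curl (u t) x‖) ∧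
                ε < Real.sqrt (1 - (inner ℝ e (‖curl (u t) y‖⁻¹ • curl (u t) y)) ^ 2)}
              ≤ ENNReal.ofReal (δ * Real.sqrt (ν / ‖curl (u t) x‖) ^ 3) :=
  aprioriMostTimesBulkAlignmentExistsAnchor_of_aprioriMostTimesBulkAlignment
    (aprioriMostTimesBulkAlignment_of_navierStokesRegularity hA)

/-- **`S ↔ W3ᵐᵗ-∃e ∧ NoTypeII`**: the re-anchored door with the residual is EXACTLY the summit (⇐ by the ∃e bridge
`navierStokesRegularity_of_existsAnchorDoor_of_noTypeII`). [folklore] -/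
theorem navierStokesRegularity_iff_existsAnchorDoor_and_noTypeII :
    _root_.NavierStokesRegularity ↔
      ((∀ (ν T : ℝ), 0 < ν → 0 < T → ∀ (u : ℝ → EuclideanSpace ℝ (Fin 3) → EuclideanSpace ℝ (Fin 3))
          (p : ℝ → EuclideanSpace ℝ (Fin 3) → ℝ), IsClassicalNSSolutionOn (Set.Ico 0 T) ν 0 u p →
          IsLerayHopfOn T ν 0 (u 0) u → HasRapidSpatialDecay (u 0) →
          ∃ lam0 : ℝ, lam0 < 1 ∧ ∃ R0 : ℝ, 0 < R0 ∧ ∃ θ : ℝ, θ < 1 ∧ ∀ κ : ℝ, 0 < κ → ∀ ε : ℝ, 0 < ε →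
            ∀ δ : ℝ, 0 < δ → ∃ M : ℝ, 0 < M ∧ ∃ E : Set ℝ,
            (∃ h0 : ℝ, 0 < h0 ∧ ∀ h : ℝ, 0 < h → h < h0 →
              MeasureTheory.volume (E ∩ Set.Ioo (T - h) T) ≤ ENNReal.ofReal (θ * h)) ∧
            ∀ t ∈ Set.Ico 0 T, t ∉ E → ∀ x : EuclideanSpace ℝ (Fin 3), M ≤ ‖curl (u t) x‖ →
              κ / (T - t) ≤ ‖curl (u t) x‖ → ∃ e : EuclideanSpace ℝ (Fin 3), ‖e‖ = 1 ∧
                MeasureTheory.volume {y : EuclideanSpace ℝ (Fin 3) | lam0 * ‖curl (u t) x‖ ≤ ‖curl (u t) y‖ ∧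
                    ‖x - y‖ ≤ R0 * Real.sqrt (ν / ‖curl (u t) x‖) ∧
                    ε < Real.sqrt (1 - (inner ℝ e (‖curl (u t) y‖⁻¹ • curl (u t) y)) ^ 2)}
                  ≤ ENNReal.ofReal (δ * Real.sqrt (ν / ‖curl (u t) x‖) ^ 3)) ∧
        Summit.NavierStokesRegularity.NavierStokesRegularity.Theses.ScaledTopAlignment.NoTypeII) :=
  ⟨fun hA => ⟨existsAnchorDoor_of_navierStokesRegularity hA, noTypeII_of_navierStokesRegularity hA⟩,
    fun h => navierStokesRegularity_of_existsAnchorDoor_of_noTypeII h.1 h.2⟩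

end Summit.NavierStokesRegularity.NavierStokesRegularity.Theorems

end
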